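import Literature.MathematicalPhysics.QuantumFieldTheory.Balaban1983to89.T4WilsonDatumBounds
import Literature.MathematicalPhysics.QuantumFieldTheory.Balaban1983to89.T4ExpWindowSmallField
import Literature.MathematicalPhysics.QuantumLattice.SU2HaarSmallBallUpper
import HarnessLib

/-!
# Line «covariant_discharge» on crux `HistoryTailL` (stmt-QuantumFields-19936) — the ONE-LINK ACTION INCREMENT of a skew left
# translation in closed form: `A_w(U with U_b ↦ h·U_b) − A_w(U) = Re((su2Quat h − 1)·su2Quat(U_b)·D_b(U))`, its cost/torque split along
# `h = exp(a·n̂)`, and the torque bound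

Cell `ym3-torus` (YM ladder rung R3 = continuum SU(2) Yang–Mills on the three-torus — a RUNG, NOT the Clay problem), width seat
`ym-ust-19936-w3` gen 8, fourth helper brick (E-4).  After (E-3) `CovariantDischargeSweepGapReduction.unboundedDepth_of_sweepGap` the
hardest stub of the line is the sweep-gap hypothesis (HGap): a lower bound on `β_K·(A(V) − A(Ψ′V))` for a sweep `Ψ` of single-link left
translations `U_b ↦ exp(a_b·n̂_b(U))·U_b`.  A sweep's action change telescopes into one-link increments evaluated at partially swept fields;
THIS FILE gives the one-link increment EXACTLY (the Wilson action is one-link quaternion-affine, lit ✓`T4WilsonLinkAffine.linkAffine_wilsonAction`):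

* §1 `wilsonAction_update_eq` (`A_w(U[b ↦ g]) = κ_b(U) + Re(su2Quat g · D_b(U))`, `D_b = wilsonDatum 1 w U b`), ★`wilsonAction_update_sub`
  (`A_w(U[b ↦ g]) − A_w(U) = Re((su2Quat g − su2Quat U_b)·D_b(U))`) and ★★`wilsonAction_update_mul_sub`
  (`A_w(U[b ↦ h·U_b]) − A_w(U) = Re((su2Quat h − 1)·(su2Quat U_b · D_b(U)))`).
* §2 along a one-parameter subgroup `h = expPoint(a·n̂)`, `‖n̂‖ = 1` (`su2Quat h = cos a + sin a·ι n̂`): ★★`wilsonAction_update_expPoint_mul_sub`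
  `A_w(U[b ↦ e^{a n̂}U_b]) − A_w(U) = (1 − cos a)·w·Σ_{p∋b} reTr U(∂p) + sin a · τ_{n̂}(U, b)` with the TORQUE
  `τ_{n̂}(U,b) = Re(ι n̂ · su2Quat U_b · D_b(U)) = −⟨n̂, imVec(su2Quat U_b · D_b(U))⟩` (`re_imQuat_mul`): a non-negative quadratic COST
  (`(1 − cos a)·w·Σ reTr ≥ 0` once the plaquettes through `b` have `reTr ≥ 0`, `cost_nonneg`) plus a LINEAR term — the one-link instance of the
  card's «`β(S(ΨU)−S(U)) = (θ/σ²)·Y + ½βΣ(da)² + DEFECT`».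
* §3 sizes: `|τ_{n̂}(U,b)| ≤ |w|·N_b` (`abs_torque_le`, `N_b = letterCount b = 2(d−1)`), `|A_w(U[b ↦ h·U_b]) − A_w(U)| ≤ ‖su2Quat h − 1‖·|w|·N_b`
  (`abs_wilsonAction_update_mul_sub_le`); the dependence of `D_b` on the OTHER links (cross terms of a sweep) is lit
  ✓`T4WilsonDatumBounds.norm_wilsonDatum_sub_le` (`3δ`-Lipschitz in the staple links).

WHAT THIS IS NOT.  One link, exact algebra: no sweep is constructed, no frame, no averaging response, no defect budget; nothing of (HGap),
`stub_unboundedDepth`, `HistoryTailL`, the rung R3, d = 4, a continuum limit or a mass gap is proved.  YM₃ on T³ is rung R3, NOT Clay.  Folklore.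
-/

noncomputable section

open scoped Quaternion RealInnerProductSpace
open Literature.MathematicalPhysics.QuantumLattice (su2Quat norm_su2Quat abs_re_le_norm)
open Literature.MathematicalPhysics.QuantumFieldTheory.Balaban1983to89
open Literature.MathematicalPhysics.QuantumFieldTheory.Balaban1983to89.T4HaarSU2Translate (su2Quat_mul su2Quat_one)
open Literature.MathematicalPhysics.QuantumFieldTheory.Balaban1983to89.T4CubeChartGnomonic (SU2)
open Literature.MathematicalPhysics.QuantumFieldTheory.Balaban1983to89.T4HaarSU2ExpChart (imQuat imQuat_apply expPoint
  su2Quat_expPoint exp_imQuat_smul norm_imQuat)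
open Literature.MathematicalPhysics.QuantumFieldTheory.Balaban1983to89.T4ExpWindowSmallField (imVec)
open Literature.MathematicalPhysics.QuantumFieldTheory.Balaban1983to89.T4WilsonLinkAffine (wilsonKappa wilsonDatum
  linkAffine_wilsonAction letterCount IsLetter)
open Literature.MathematicalPhysics.QuantumFieldTheory.Balaban1983to89.T4WilsonDatumBounds (stapleTrace
  re_su2Quat_mul_wilsonDatum_self norm_wilsonDatum_le le_stapleTrace)

namespace Summit.QuantumFields.YangMills.Theorems.CovariantDischargeOneLinkIncrement

variable {P : Params} {j : ℕ} [DecidableEq (PBond P j)]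

/-! ## §1 The exact one-link increment -/

/-- `A_w(U[b ↦ g]) = κ_b(U) + Re(su2Quat g · D_b(U))` with `D_b = wilsonDatum 1 w U b` (lit `linkAffine_wilsonAction` at `c = 1`). [folklore] -/
theorem wilsonAction_update_eq (w : ℝ) (u : GaugeField P j SU2) (b : PBond P j) (g : SU2) :
    wilsonAction w (Function.update u b g) = wilsonKappa 1 w u b + (su2Quat g * wilsonDatum 1 w u b).re := by
  have H := linkAffine_wilsonAction 1 w u b g
  simpa only [one_mul] using H

/-- **ONE-LINK INCREMENT**: `A_w(U[b ↦ g]) − A_w(U) = Re((su2Quat g − su2Quat U_b)·D_b(U))`. [folklore] -/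
theorem wilsonAction_update_sub (w : ℝ) (u : GaugeField P j SU2) (b : PBond P j) (g : SU2) :
    wilsonAction w (Function.update u b g) - wilsonAction w u = ((su2Quat g - su2Quat (u b)) * wilsonDatum 1 w u b).re := by
  have h1 := wilsonAction_update_eq w u b g
  have h2 := wilsonAction_update_eq w u b (u b)
  rw [Function.update_eq_self] at h2
  rw [h1, h2, sub_mul, Quaternion.re_sub]
  ring

/-- **ONE-LINK INCREMENT OF A LEFT TRANSLATION**: `A_w(U[b ↦ h·U_b]) − A_w(U) = Re((su2Quat h − 1)·(su2Quat U_b · D_b(U)))`. [folklore] -/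
theorem wilsonAction_update_mul_sub (w : ℝ) (u : GaugeField P j SU2) (b : PBond P j) (h : SU2) :
    wilsonAction w (Function.update u b (h * u b)) - wilsonAction w u =
      ((su2Quat h - 1) * (su2Quat (u b) * wilsonDatum 1 w u b)).re := by
  rw [wilsonAction_update_sub, su2Quat_mul, sub_mul, sub_mul, one_mul, mul_assoc]

/-- The same for the unit-weight action `wilsonAction4 = wilsonAction 1`. [folklore] -/
theorem wilsonAction4_update_mul_sub (u : GaugeField P j SU2) (b : PBond P j) (h : SU2) :
    wilsonAction4 (Function.update u b (h * u b)) - wilsonAction4 u =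
      ((su2Quat h - 1) * (su2Quat (u b) * wilsonDatum 1 1 u b)).re :=
  wilsonAction_update_mul_sub 1 u b h

/-! ## §2 Along a one-parameter subgroup: cost/torque split -/

/-- `su2Quat (expPoint (a·n̂)) = cos a + sin a · ι n̂` for a unit direction `n̂`. [folklore] -/
theorem su2Quat_expPoint_smul {n : EuclideanSpace ℝ (Fin 3)} (hn : ‖n‖ = 1) (a : ℝ) :
    su2Quat (expPoint (a • n)) = (Real.cos a : ℍ) + Real.sin a • imQuat n := by
  rw [su2Quat_expPoint, exp_imQuat_smul hn]

/-- The torque in vector form: `Re(ι n̂ · q) = −⟨n̂, imVec q⟩`. [folklore] -/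
theorem re_imQuat_mul (n : EuclideanSpace ℝ (Fin 3)) (q : ℍ) : (imQuat n * q).re = -⟪n, imVec q⟫ := by
  rw [Quaternion.re_mul, imQuat_apply, EuclideanSpace.inner_eq_star_dotProduct]
  simp [imVec, Fin.sum_univ_three, dotProduct]
  ring

/-- **COST/TORQUE SPLIT**: for `h = expPoint(a·n̂)`, `‖n̂‖ = 1`,
`A_w(U[b ↦ h·U_b]) − A_w(U) = (1 − cos a)·(w·Σ_{p∋b} reTr U(∂p)) + sin a·Re(ι n̂ · su2Quat U_b · D_b(U))`. [folklore] -/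
theorem wilsonAction_update_expPoint_mul_sub (w : ℝ) (u : GaugeField P j SU2) (b : PBond P j)
    {n : EuclideanSpace ℝ (Fin 3)} (hn : ‖n‖ = 1) (a : ℝ) :
    wilsonAction w (Function.update u b (expPoint (a • n) * u b)) - wilsonAction w u =
      (1 - Real.cos a) * (w * stapleTrace u b) +
        Real.sin a * (imQuat n * (su2Quat (u b) * wilsonDatum 1 w u b)).re := by
  rw [wilsonAction_update_mul_sub, su2Quat_expPoint_smul hn]
  have hX : (su2Quat (u b) * wilsonDatum 1 w u b).re = -(1 * w) * stapleTrace u b :=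
    re_su2Quat_mul_wilsonDatum_self 1 w u b
  rw [sub_mul, add_mul, one_mul, Quaternion.re_sub, Quaternion.re_add, Quaternion.coe_mul_eq_smul, smul_mul_assoc,
    Quaternion.re_smul, Quaternion.re_smul, hX, smul_eq_mul, smul_eq_mul]
  ring

/-- The same split for `wilsonAction4`, torque in vector form:
`A(U[b ↦ h·U_b]) − A(U) = (1 − cos a)·Σ_{p∋b} reTr U(∂p) − sin a·⟨n̂, imVec(su2Quat U_b · D_b(U))⟩`. [folklore] -/
theorem wilsonAction4_update_expPoint_mul_sub (u : GaugeField P j SU2) (b : PBond P j)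
    {n : EuclideanSpace ℝ (Fin 3)} (hn : ‖n‖ = 1) (a : ℝ) :
    wilsonAction4 (Function.update u b (expPoint (a • n) * u b)) - wilsonAction4 u =
      (1 - Real.cos a) * stapleTrace u b - Real.sin a * ⟪n, imVec (su2Quat (u b) * wilsonDatum 1 1 u b)⟫ := by
  have h := wilsonAction_update_expPoint_mul_sub 1 u b hn a
  rw [re_imQuat_mul, one_mul] at h
  simp only [wilsonAction4]
  rw [h]
  ring

/-- **THE COST IS NON-NEGATIVE IN THE SMALL FIELD**: if every plaquette through `b` has `reTr U(∂p) ≥ 1 − ε` with `ε ≤ 1` and `w ≥ 0`, then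
`0 ≤ (1 − cos a)·(w·Σ_{p∋b} reTr U(∂p))` and indeed `(1 − cos a)·w·N_b·(1 − ε) ≤` it. [folklore] -/
theorem cost_lower_bound {w ε : ℝ} (hw : 0 ≤ w) {u : GaugeField P j SU2} {b : PBond P j}
    (hsf : ∀ p, IsLetter b p → 1 - ε ≤ reTr (GaugeField.plaqHol u p)) (a : ℝ) :
    (1 - Real.cos a) * (w * ((letterCount b : ℝ) * (1 - ε))) ≤ (1 - Real.cos a) * (w * stapleTrace u b) :=
  mul_le_mul_of_nonneg_left (mul_le_mul_of_nonneg_left (le_stapleTrace hsf) hw) (sub_nonneg.mpr (Real.cos_le_one a))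

/-- In particular the cost is `≥ 0` when `reTr ≥ 0` on the plaquettes through `b` (`ε = 1`) and `w ≥ 0`. [folklore] -/
theorem cost_nonneg {w : ℝ} (hw : 0 ≤ w) {u : GaugeField P j SU2} {b : PBond P j}
    (hsf : ∀ p, IsLetter b p → 0 ≤ reTr (GaugeField.plaqHol u p)) (a : ℝ) :
    0 ≤ (1 - Real.cos a) * (w * stapleTrace u b) := by
  have h := cost_lower_bound (ε := 1) hw (u := u) (b := b) (fun p hp => by simpa using hsf p hp) a
  simpa using h

/-! ## §3 Sizes -/

/-- **TORQUE BOUND**: `|Re(ι n̂ · su2Quat U_b · D_b(U))| ≤ |w|·N_b` (`‖ι n̂‖ = ‖su2Quat U_b‖ = 1`, `‖D_b‖ ≤ |w|·N_b`). [folklore] -/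
theorem abs_torque_le (w : ℝ) (u : GaugeField P j SU2) (b : PBond P j) {n : EuclideanSpace ℝ (Fin 3)} (hn : ‖n‖ = 1) :
    |(imQuat n * (su2Quat (u b) * wilsonDatum 1 w u b)).re| ≤ |w| * (letterCount b : ℝ) := by
  refine (abs_re_le_norm _).trans ?_
  rw [norm_mul, norm_mul, norm_imQuat, hn, norm_su2Quat, one_mul, one_mul]
  simpa only [one_mul] using norm_wilsonDatum_le 1 w u b

/-- **INCREMENT BOUND**: `|A_w(U[b ↦ h·U_b]) − A_w(U)| ≤ ‖su2Quat h − 1‖·|w|·N_b`. [folklore] -/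
theorem abs_wilsonAction_update_mul_sub_le (w : ℝ) (u : GaugeField P j SU2) (b : PBond P j) (h : SU2) :
    |wilsonAction w (Function.update u b (h * u b)) - wilsonAction w u| ≤ ‖su2Quat h - 1‖ * (|w| * (letterCount b : ℝ)) := by
  rw [wilsonAction_update_mul_sub]
  refine (abs_re_le_norm _).trans ?_
  rw [norm_mul, norm_mul, norm_su2Quat, one_mul]
  exact mul_le_mul_of_nonneg_left (by simpa only [one_mul] using norm_wilsonDatum_le 1 w u b) (norm_nonneg _)

end Summit.QuantumFields.YangMills.Theorems.CovariantDischargeOneLinkIncrement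

end
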